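import Summits.CriticalPhenomena.PercolationContinuityZ3.Theorems.PercNearOneGluingNoHeavyLowerTailQ7PsiStarBounds
import HarnessLib

/-!
# `NoHeavyLowerTail` (stmt-CriticalPhenomena-4575) — the peeled form of Question 7 for three relays on
# Kozma–Nitzan's Theorem-4 class (observer attached only to relays), for every monotone cluster property

Support file (`--supports stmt-CriticalPhenomena-4575`), coupling seat `prim-cplus-coupling` (gen 5).  No
definitions, no named facts, no sorries.

* `Q7Psi.gpsi_three_star` — **Theorem.** Finite weighted graph on `V`; observer `o`; relays `x, y, z`
  (pairwise distinct, `≠ o`) such that every pair `s(o,u)` with `u ∉ {x,y,z}` has weight `0` (Kozma–Nitzan's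
  class "`0` isolated in `G ∖ A`", Theorem 4, pp. 12–14); `F` a monotone function of vertex sets (a monotone
  cluster property, §5.1 p. 31).  If `E F(C(z)) ≤ E F(C(x))` and `E F(C(z)) ≤ E F(C(y))`, then
  `E[F(C(z)); o ↔ {x,y}] ≤ E[F(C(o)); o ↔ {x,y}]`.
  This is the DESIGNATED form (the weak relay `z` is the one with the least mean, as in Question 7, p. 36) of
  Kozma–Nitzan's Conjecture 4 / Theorem 8 for three relays on the Theorem-4 class; with `F(S) =` the
  probability that `S` has an open edge to a further vertex `b` it is the peeled form of Question 7 (tree: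
  `Q7Psi.q7_of_psi`) for `|A| = 3` and observers attached only to `A ∪ {b}` (seat memo A5-COUPLING-gen5.md §10).
  Proof: condition on the star `σ_B` of `o`, `B ⊆ {x,y,z}` (`KNPreFKG.setIntegral_eq_sum_inter_starEvent`);
  under each star the clusters are read off the clusters off `o` (file `…Q7PsiStarAux`), and the star is
  independent of the pairs off `o` (`KNPreFKG.setIntegral_starEvent_comp_restrict`); this bounds
  `Ψ := E[F(C(o)) − F(C(z)); o↔{x,y}]`, `Ψ − Δ_x` and `Ψ − Δ_y` (`Δ_a := E F(C(a)) − E F(C(z)) ≥ 0`) below by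
  combinations of the star probabilities and five integrals over the graph without `o`; two of those
  integrals are signed by Kozma–Nitzan's Lemma 3(ii) for real cluster properties on `G ∖ {o}`
  (`KozmaNitzan2024_lemma3_ii_real`); a four-case sign analysis finishes.
[cite: KozmaNitzan2024, Question 7 (p. 36), Theorem 4 and Lemma 5 (pp. 12–14), Lemma 3(ii) (pp. 6–7), §5.1 (pp. 31–32)]
-/

namespace Summit.CriticalPhenomena.PercolationContinuityZ3.Theorems

open MeasureTheory Set Literature.Probability.LatticeModels Literature.Probability.Percolation
open scoped Classical
open KNPreFKG Q7Psi.Star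

noncomputable section

namespace Q7Psi

variable {V : Type*} [Fintype V]

/-- **Signing the `D`-world integral by Lemma 3(ii) on `G ∖ {o}`**: if one of the strong relays has at least the
mean of `z` off `o` (`0 ≤ α°` or `0 ≤ β°`), then `DD° = ∫ 𝟙{z' ↮ x', y'}(F'(C x' ∪ C y') − F'(C z'))∘r ≥ 0`
(`{z' ↮ y'}` resp. `{z' ↮ x'}` is a decreasing event of the cluster of `z'`).
[cite: KozmaNitzan2024, Lemma 3(ii) (pp. 6–7), §5.1 (p. 31)] -/
theorem dd_nonneg (w : Sym2 V → unitInterval) (o x y z : V) (hxo : x ≠ o) (hyo : y ≠ o) (hzo : z ≠ o)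
    (F : Set V → ℝ) (hF : ∀ S T : Set V, S ⊆ T → F S ≤ F T)
    (h : 0 ≤ ∫ ω, (F (Subtype.val '' openCluster (restrictConfig (Subtype.val : ({o}ᶜ : Set V) → V) ω)
            ⟨x, mem_compl_singleton_iff.2 hxo⟩) -
          F (Subtype.val '' openCluster (restrictConfig (Subtype.val : ({o}ᶜ : Set V) → V) ω)
            ⟨z, mem_compl_singleton_iff.2 hzo⟩)) ∂(prodBernoulli w) ∨
      0 ≤ ∫ ω, (F (Subtype.val '' openCluster (restrictConfig (Subtype.val : ({o}ᶜ : Set V) → V) ω)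
            ⟨y, mem_compl_singleton_iff.2 hyo⟩) -
          F (Subtype.val '' openCluster (restrictConfig (Subtype.val : ({o}ᶜ : Set V) → V) ω)
            ⟨z, mem_compl_singleton_iff.2 hzo⟩)) ∂(prodBernoulli w)) :
    0 ≤ ∫ ω, (if (openGraph (restrictConfig (Subtype.val : ({o}ᶜ : Set V) → V) ω)).Reachable
              ⟨z, mem_compl_singleton_iff.2 hzo⟩ ⟨x, mem_compl_singleton_iff.2 hxo⟩ ∨
            (openGraph (restrictConfig (Subtype.val : ({o}ᶜ : Set V) → V) ω)).Reachable
              ⟨z, mem_compl_singleton_iff.2 hzo⟩ ⟨y, mem_compl_singleton_iff.2 hyo⟩ then (0 : ℝ)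
          else F (Subtype.val '' openCluster (restrictConfig (Subtype.val : ({o}ᶜ : Set V) → V) ω)
              ⟨x, mem_compl_singleton_iff.2 hxo⟩ ∪
            Subtype.val '' openCluster (restrictConfig (Subtype.val : ({o}ᶜ : Set V) → V) ω)
              ⟨y, mem_compl_singleton_iff.2 hyo⟩) -
            F (Subtype.val '' openCluster (restrictConfig (Subtype.val : ({o}ᶜ : Set V) → V) ω)
              ⟨z, mem_compl_singleton_iff.2 hzo⟩)) ∂(prodBernoulli w) := by
  classical
  set μ := prodBernoulli w with hμ
  set S : Set V := {o}ᶜ with hS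
  haveI : Fintype S := Fintype.ofFinite S
  set r := restrictConfig (Subtype.val : S → V) with hr
  set w' : Sym2 S → unitInterval := w ∘ Sym2.map (Subtype.val : S → V) with hw'
  set μ' := prodBernoulli w' with hμ'
  set x' : S := ⟨x, mem_compl_singleton_iff.2 hxo⟩ with hx'
  set y' : S := ⟨y, mem_compl_singleton_iff.2 hyo⟩ with hy'
  set z' : S := ⟨z, mem_compl_singleton_iff.2 hzo⟩ with hz'
  set F' : Set S → ℝ := fun T => F (Subtype.val '' T) with hF'
  have hF'mono : ∀ T T' : Set S, T ⊆ T' → F' T ≤ F' T' := fun T T' hTT' => hF _ _ (image_mono hTT')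
  have hmeasS : ∀ T : Set (BondConfig S), MeasurableSet T := fun _ => MeasurableSet.of_discrete
  have hint' : ∀ (k : BondConfig S → ℝ) (T : Set (BondConfig S)), IntegrableOn k T μ' :=
    fun k T => (Integrable.of_finite).integrableOn
  -- move every integral to `G ∖ {o}`
  have tr : ∀ k : BondConfig S → ℝ, ∫ ω, k (r ω) ∂μ = ∫ ω', k ω' ∂μ' := fun k => by
    rw [hμ', hw', hr, integral_comp_restrictConfig_val]
  set dd : BondConfig S → ℝ := fun ω' => if (openGraph ω').Reachable z' x' ∨ (openGraph ω').Reachable z' y' then (0 : ℝ)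
      else F' (openCluster ω' x' ∪ openCluster ω' y') - F' (openCluster ω' z') with hdd
  have goal_eq : (∫ ω, (if (openGraph (r ω)).Reachable z' x' ∨ (openGraph (r ω)).Reachable z' y' then (0 : ℝ)
      else F (Subtype.val '' openCluster (r ω) x' ∪ Subtype.val '' openCluster (r ω) y') -
        F (Subtype.val '' openCluster (r ω) z')) ∂μ) = ∫ ω', dd ω' ∂μ' := by
    rw [← tr dd]
    refine integral_congr_ae (Filter.Eventually.of_forall fun ω => ?_)
    simp only [hdd, hF', image_union]
  rw [goal_eq]
  -- the two one-sided comparison functions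
  set kx : BondConfig S → ℝ := fun ω' => F' (openCluster ω' x') - F' (openCluster ω' z') with hkx
  set ky : BondConfig S → ℝ := fun ω' => F' (openCluster ω' y') - F' (openCluster ω' z') with hky
  have hαx : (∫ ω, (F (Subtype.val '' openCluster (r ω) x') - F (Subtype.val '' openCluster (r ω) z')) ∂μ) =
      ∫ ω', kx ω' ∂μ' := by rw [← tr kx]
  have hαy : (∫ ω, (F (Subtype.val '' openCluster (r ω) y') - F (Subtype.val '' openCluster (r ω) z')) ∂μ) =
      ∫ ω', ky ω' ∂μ' := by rw [← tr ky]
  rw [hαx, hαy] at h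
  -- `dd ≥ 𝟙_{N_y} kx` and `dd ≥ 𝟙_{N_x} ky` pointwise, `N_y = {z' ↮ y'}`, `N_x = {z' ↮ x'}`
  set Ny : Set (BondConfig S) := {ω' | ¬ (openGraph ω').Reachable z' y'} with hNy
  set Nx : Set (BondConfig S) := {ω' | ¬ (openGraph ω').Reachable z' x'} with hNx
  have hdd_x : ∀ ω', Ny.indicator kx ω' ≤ dd ω' := by
    intro ω'
    by_cases hzy : (openGraph ω').Reachable z' y'
    · have : ω' ∉ Ny := fun hh => hh hzy
      rw [indicator_of_notMem this, hdd]
      simp only [hzy, or_true, if_true, le_refl]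
    · rw [indicator_of_mem (show ω' ∈ Ny from hzy), hdd]
      by_cases hzx : (openGraph ω').Reachable z' x'
      · simp only [hzx, true_or, if_true, hkx, openCluster_eq_of_reachable hzx, sub_self, le_refl]
      · simp only [hzx, hzy, or_self, if_false, hkx]
        linarith [hF'mono (openCluster ω' x') (openCluster ω' x' ∪ openCluster ω' y') subset_union_left]
  have hdd_y : ∀ ω', Nx.indicator ky ω' ≤ dd ω' := by
    intro ω'
    by_cases hzx : (openGraph ω').Reachable z' x'
    · have : ω' ∉ Nx := fun hh => hh hzx
      rw [indicator_of_notMem this, hdd]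
      simp only [hzx, true_or, if_true, le_refl]
    · rw [indicator_of_mem (show ω' ∈ Nx from hzx), hdd]
      by_cases hzy : (openGraph ω').Reachable z' y'
      · simp only [hzy, or_true, if_true, hky, openCluster_eq_of_reachable hzy, sub_self, le_refl]
      · simp only [hzx, hzy, or_self, if_false, hky]
        linarith [hF'mono (openCluster ω' y') (openCluster ω' x' ∪ openCluster ω' y') subset_union_right]
  -- Lemma 3(ii), real form, on `G ∖ {o}`
  have hNy_eq : Ny = {ω' | openEdgeCluster ω' z' ∈ disconnFamily z' ({y'} : Set S)} := by
    rw [← setOf_forall_not_reachable_eq]; ext ω'; simp [hNy]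
  have hNx_eq : Nx = {ω' | openEdgeCluster ω' z' ∈ disconnFamily z' ({x'} : Set S)} := by
    rw [← setOf_forall_not_reachable_eq]; ext ω'; simp [hNx]
  rcases h with h | h
  · have hyp' : ∫ ω', F' (openCluster ω' z') ∂μ' ≤ ∫ ω', F' (openCluster ω' x') ∂μ' := by
      have e := integral_sub (Integrable.of_finite : Integrable (fun ω' => F' (openCluster ω' x')) μ')
        (Integrable.of_finite : Integrable (fun ω' => F' (openCluster ω' z')) μ')
      have : (∫ ω', kx ω' ∂μ') = ∫ ω', (F' (openCluster ω' x') - F' (openCluster ω' z')) ∂μ' := rfl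
      linarith
    have L3 := KozmaNitzan2024_lemma3_ii_real w' z' x' F' hF'mono hyp' (isLowerSet_disconnFamily z' ({y'} : Set S))
    rw [← hNy_eq] at L3
    have e1 : ∫ ω' in Ny, kx ω' ∂μ' = ∫ ω' in Ny, F' (openCluster ω' x') ∂μ' - ∫ ω' in Ny, F' (openCluster ω' z') ∂μ' :=
      integral_sub (hint' _ _) (hint' _ _)
    calc (0 : ℝ) ≤ ∫ ω' in Ny, kx ω' ∂μ' := by rw [e1]; linarith
      _ = ∫ ω', Ny.indicator kx ω' ∂μ' := (integral_indicator (hmeasS Ny)).symm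
      _ ≤ ∫ ω', dd ω' ∂μ' := integral_mono (Integrable.of_finite) (Integrable.of_finite) hdd_x
  · have hyp' : ∫ ω', F' (openCluster ω' z') ∂μ' ≤ ∫ ω', F' (openCluster ω' y') ∂μ' := by
      have e := integral_sub (Integrable.of_finite : Integrable (fun ω' => F' (openCluster ω' y')) μ')
        (Integrable.of_finite : Integrable (fun ω' => F' (openCluster ω' z')) μ')
      have : (∫ ω', ky ω' ∂μ') = ∫ ω', (F' (openCluster ω' y') - F' (openCluster ω' z')) ∂μ' := rfl
      linarith
    have L3 := KozmaNitzan2024_lemma3_ii_real w' z' y' F' hF'mono hyp' (isLowerSet_disconnFamily z' ({x'} : Set S))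
    rw [← hNx_eq] at L3
    have e1 : ∫ ω' in Nx, ky ω' ∂μ' = ∫ ω' in Nx, F' (openCluster ω' y') ∂μ' - ∫ ω' in Nx, F' (openCluster ω' z') ∂μ' :=
      integral_sub (hint' _ _) (hint' _ _)
    calc (0 : ℝ) ≤ ∫ ω' in Nx, ky ω' ∂μ' := by rw [e1]; linarith
      _ = ∫ ω', Nx.indicator ky ω' ∂μ' := (integral_indicator (hmeasS Nx)).symm
      _ ≤ ∫ ω', dd ω' ∂μ' := integral_mono (Integrable.of_finite) (Integrable.of_finite) hdd_y

/-- **Signing the `{c,z}`-star integral by Lemma 3(ii) on `G ∖ {o}`**: if the strong relay `a` has at most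
the mean of `z` off `o` (`α° ≤ 0`), then `η° = ∫ 𝟙{a' ↮ c', z'}(F'(C a') − F'(C z'))∘r ≤ 0`
(`{a' ↮ c', z'}` is a decreasing event of the cluster of `a'`). [cite: KozmaNitzan2024, Lemma 3(ii) (pp. 6–7), §5.1 (p. 31)] -/
theorem eta_nonpos (w : Sym2 V → unitInterval) (o a c z : V) (hao : a ≠ o) (hco : c ≠ o) (hzo : z ≠ o)
    (F : Set V → ℝ) (hF : ∀ S T : Set V, S ⊆ T → F S ≤ F T)
    (h : ∫ ω, (F (Subtype.val '' openCluster (restrictConfig (Subtype.val : ({o}ᶜ : Set V) → V) ω)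
            ⟨a, mem_compl_singleton_iff.2 hao⟩) -
          F (Subtype.val '' openCluster (restrictConfig (Subtype.val : ({o}ᶜ : Set V) → V) ω)
            ⟨z, mem_compl_singleton_iff.2 hzo⟩)) ∂(prodBernoulli w) ≤ 0) :
    ∫ ω, (if (openGraph (restrictConfig (Subtype.val : ({o}ᶜ : Set V) → V) ω)).Reachable
              ⟨a, mem_compl_singleton_iff.2 hao⟩ ⟨c, mem_compl_singleton_iff.2 hco⟩ ∨
            (openGraph (restrictConfig (Subtype.val : ({o}ᶜ : Set V) → V) ω)).Reachable
              ⟨a, mem_compl_singleton_iff.2 hao⟩ ⟨z, mem_compl_singleton_iff.2 hzo⟩ then (0 : ℝ)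
          else F (Subtype.val '' openCluster (restrictConfig (Subtype.val : ({o}ᶜ : Set V) → V) ω)
              ⟨a, mem_compl_singleton_iff.2 hao⟩) -
            F (Subtype.val '' openCluster (restrictConfig (Subtype.val : ({o}ᶜ : Set V) → V) ω)
              ⟨z, mem_compl_singleton_iff.2 hzo⟩)) ∂(prodBernoulli w) ≤ 0 := by
  classical
  set μ := prodBernoulli w with hμ
  set S : Set V := {o}ᶜ with hS
  haveI : Fintype S := Fintype.ofFinite S
  set r := restrictConfig (Subtype.val : S → V) with hr
  set w' : Sym2 S → unitInterval := w ∘ Sym2.map (Subtype.val : S → V) with hw'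
  set μ' := prodBernoulli w' with hμ'
  set a' : S := ⟨a, mem_compl_singleton_iff.2 hao⟩ with ha'
  set c' : S := ⟨c, mem_compl_singleton_iff.2 hco⟩ with hc'
  set z' : S := ⟨z, mem_compl_singleton_iff.2 hzo⟩ with hz'
  set F' : Set S → ℝ := fun T => F (Subtype.val '' T) with hF'
  have hF'mono : ∀ T T' : Set S, T ⊆ T' → F' T ≤ F' T' := fun T T' hTT' => hF _ _ (image_mono hTT')
  have hmeasS : ∀ T : Set (BondConfig S), MeasurableSet T := fun _ => MeasurableSet.of_discrete
  have hint' : ∀ (k : BondConfig S → ℝ) (T : Set (BondConfig S)), IntegrableOn k T μ' :=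
    fun k T => (Integrable.of_finite).integrableOn
  have tr : ∀ k : BondConfig S → ℝ, ∫ ω, k (r ω) ∂μ = ∫ ω', k ω' ∂μ' := fun k => by
    rw [hμ', hw', hr, integral_comp_restrictConfig_val]
  set ka : BondConfig S → ℝ := fun ω' => F' (openCluster ω' a') - F' (openCluster ω' z') with hka
  set N : Set (BondConfig S) := {ω' | ∀ u ∈ ({c', z'} : Set S), ¬ (openGraph ω').Reachable a' u} with hN
  set ke : BondConfig S → ℝ := fun ω' => if (openGraph ω').Reachable a' c' ∨ (openGraph ω').Reachable a' z' then (0 : ℝ)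
      else F' (openCluster ω' a') - F' (openCluster ω' z') with hke
  have goal_eq : (∫ ω, (if (openGraph (r ω)).Reachable a' c' ∨ (openGraph (r ω)).Reachable a' z' then (0 : ℝ)
      else F (Subtype.val '' openCluster (r ω) a') - F (Subtype.val '' openCluster (r ω) z')) ∂μ) = ∫ ω', ke ω' ∂μ' := by
    rw [← tr ke]
  rw [goal_eq]
  have hke : ke = N.indicator ka := by
    funext ω'
    by_cases hh : (openGraph ω').Reachable a' c' ∨ (openGraph ω').Reachable a' z'
    · have : ω' ∉ N := by
        intro hn
        rcases hh with hh | hh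
        · exact hn c' (Or.inl rfl) hh
        · exact hn z' (Or.inr rfl) hh
      rw [indicator_of_notMem this]; simp only [ke, hh, if_true]
    · have : ω' ∈ N := by
        intro u hu
        rcases hu with rfl | rfl
        · exact fun hh' => hh (Or.inl hh')
        · exact fun hh' => hh (Or.inr hh')
      rw [indicator_of_mem this]; simp only [ke, hh, if_false, hka]
  have hα : (∫ ω, (F (Subtype.val '' openCluster (r ω) a') - F (Subtype.val '' openCluster (r ω) z')) ∂μ) =
      ∫ ω', ka ω' ∂μ' := by rw [← tr ka]
  rw [hα] at h
  have hyp' : ∫ ω', F' (openCluster ω' a') ∂μ' ≤ ∫ ω', F' (openCluster ω' z') ∂μ' := by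
    have e := integral_sub (Integrable.of_finite : Integrable (fun ω' => F' (openCluster ω' a')) μ')
      (Integrable.of_finite : Integrable (fun ω' => F' (openCluster ω' z')) μ')
    have : (∫ ω', ka ω' ∂μ') = ∫ ω', (F' (openCluster ω' a') - F' (openCluster ω' z')) ∂μ' := rfl
    linarith
  have hN_eq : N = {ω' | openEdgeCluster ω' a' ∈ disconnFamily a' ({c', z'} : Set S)} := setOf_forall_not_reachable_eq a' _
  have L3 := KozmaNitzan2024_lemma3_ii_real w' a' z' F' hF'mono hyp' (isLowerSet_disconnFamily a' ({c', z'} : Set S))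
  rw [← hN_eq] at L3
  have e1 : ∫ ω' in N, ka ω' ∂μ' = ∫ ω' in N, F' (openCluster ω' a') ∂μ' - ∫ ω' in N, F' (openCluster ω' z') ∂μ' :=
    integral_sub (hint' _ _) (hint' _ _)
  rw [hke, integral_indicator (hmeasS N), e1]
  linarith

/-- The real-arithmetic case analysis behind `gpsi_three_star`. [folklore] -/
theorem star_arith {Ψ Δx Δy α β D ηx ηy sE sx sy sz sxy sxz syz : ℝ}
    (h0E : 0 ≤ sE) (h0x : 0 ≤ sx) (h0y : 0 ≤ sy) (h0z : 0 ≤ sz) (h0xy : 0 ≤ sxy) (h0xz : 0 ≤ sxz) (h0yz : 0 ≤ syz)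
    (hΔx : 0 ≤ Δx) (hΔy : 0 ≤ Δy) (P1 : sx * α + sy * β + sxy * D ≤ Ψ)
    (P2x : -(sE * α) + sy * (β - α) - sz * α - syz * ηx ≤ Ψ - Δx)
    (P2y : -(sE * β) + sx * (α - β) - sz * β - sxz * ηy ≤ Ψ - Δy)
    (L1 : 0 ≤ α ∨ 0 ≤ β → 0 ≤ D) (L2x : α ≤ 0 → ηx ≤ 0) (L2y : β ≤ 0 → ηy ≤ 0) : 0 ≤ Ψ := by
  by_cases ha : 0 ≤ α <;> by_cases hb : 0 ≤ β
  · have hD := L1 (Or.inl ha)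
    nlinarith [mul_nonneg h0x ha, mul_nonneg h0y hb, mul_nonneg h0xy hD]
  · push Not at hb
    have hη := L2y hb.le
    nlinarith [mul_nonneg h0E (neg_nonneg.2 hb.le), mul_nonneg h0x (show 0 ≤ α - β by linarith),
      mul_nonneg h0z (neg_nonneg.2 hb.le), mul_nonneg h0xz (neg_nonneg.2 hη)]
  · push Not at ha
    have hη := L2x ha.le
    nlinarith [mul_nonneg h0E (neg_nonneg.2 ha.le), mul_nonneg h0y (show 0 ≤ β - α by linarith),
      mul_nonneg h0z (neg_nonneg.2 ha.le), mul_nonneg h0yz (neg_nonneg.2 hη)]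
  · push Not at ha hb
    have hηx := L2x ha.le
    have hηy := L2y hb.le
    -- weights `T = sE + sx + sz` on the `x`-inequality and `sy` on the `y`-inequality
    have key : (sE + sx + sz + sy) * Ψ ≥ (sE + sx + sz) * Δx + sy * Δy +
        (-α) * ((sE + sx + sz) * (sE + sy + sz) - sx * sy) + (sE + sx + sz) * (syz * (-ηx)) + sy * (sxz * (-ηy)) := by
      nlinarith [P2x, P2y, h0E, h0x, h0y, h0z]
    have hprod : sx * sy ≤ (sE + sx + sz) * (sE + sy + sz) := by nlinarith
    have hpos : 0 ≤ (-α) * ((sE + sx + sz) * (sE + sy + sz) - sx * sy) :=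
      mul_nonneg (by linarith) (by linarith)
    have h3 : 0 ≤ (sE + sx + sz) * (syz * (-ηx)) := mul_nonneg (by linarith) (mul_nonneg h0yz (by linarith))
    have h4 : 0 ≤ sy * (sxz * (-ηy)) := mul_nonneg h0y (mul_nonneg h0xz (by linarith))
    by_cases hT : 0 < sE + sx + sz + sy
    · have hTΨ : 0 ≤ (sE + sx + sz + sy) * Ψ := by
        nlinarith [mul_nonneg (show (0:ℝ) ≤ sE + sx + sz by linarith) hΔx, mul_nonneg h0y hΔy]
      by_contra hneg
      push Not at hneg
      have : (sE + sx + sz + sy) * Ψ < 0 := mul_neg_of_pos_of_neg hT hneg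
      linarith
    · have hsum0 : sE + sx + sz + sy = 0 := le_antisymm (not_lt.1 hT) (by linarith)
      have hE0 : sE = 0 := by linarith
      have hy0 : sy = 0 := by linarith
      have hz0 : sz = 0 := by linarith
      rw [hE0, hy0, hz0] at P2x
      nlinarith [mul_nonneg h0yz (neg_nonneg.2 hηx)]

/-- **The peeled form of Question 7 for three relays on the Theorem-4 class, for every monotone cluster
property.**  Let `o, x, y, z` be distinct vertices of a finite weighted graph such that every pair `s(o,u)` with
`u ∉ {x, y, z}` has weight `0`, and let `F` be monotone on vertex sets.  If `E F(C(z)) ≤ E F(C(x))` and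
`E F(C(z)) ≤ E F(C(y))` then `E[F(C(z)); o ↔ {x,y}] ≤ E[F(C(o)); o ↔ {x,y}]`.
(The min-version — some relay `a` with `E[F(C(a)); o↔A] ≤ E[F(C(o)); o↔A]` — is Kozma–Nitzan's Theorem 8 /
Theorem 4; here the weak relay is the one with the least unconditional mean, as in Question 7.)
[cite: KozmaNitzan2024, Question 7 (p. 36), Theorem 4 and Lemma 5 (pp. 12–14), Lemma 3(ii) (pp. 6–7), §5.1 (pp. 31–32)] -/
theorem gpsi_three_star (w : Sym2 V → unitInterval) (o x y z : V) (hxo : x ≠ o) (hyo : y ≠ o) (hzo : z ≠ o)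
    (hxy : x ≠ y) (hxz : x ≠ z) (hyz : y ≠ z) (hiso : ∀ u, u ≠ o → u ∉ ({x, y, z} : Finset V) → w s(o, u) = 0)
    (F : Set V → ℝ) (hF : ∀ S T : Set V, S ⊆ T → F S ≤ F T)
    (hx : ∫ ω, F (openCluster ω z) ∂(prodBernoulli w) ≤ ∫ ω, F (openCluster ω x) ∂(prodBernoulli w))
    (hy : ∫ ω, F (openCluster ω z) ∂(prodBernoulli w) ≤ ∫ ω, F (openCluster ω y) ∂(prodBernoulli w)) :
    ∫ ω in (openConn o x ∪ openConn o y), F (openCluster ω z) ∂(prodBernoulli w) ≤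
      ∫ ω in (openConn o x ∪ openConn o y), F (openCluster ω o) ∂(prodBernoulli w) := by
  set μ := prodBernoulli w with hμ
  have hint : ∀ (k : BondConfig V → ℝ) (T : Set (BondConfig V)), IntegrableOn k T μ :=
    fun k T => (Integrable.of_finite).integrableOn
  have hiso' : ∀ u, u ≠ o → u ∉ ({y, x, z} : Finset V) → w s(o, u) = 0 := by
    intro u hu hu'
    refine hiso u hu ?_
    rwa [Finset.insert_comm] at hu'
  -- the five inputs
  have P1 := psi_lower w o x y z hxo hyo hzo hxy hxz hyz hiso F hF
  have P2x := psi_sub_delta_lower w o x y z hxo hyo hzo hxy hxz hyz hiso F hF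
  have P2y := psi_sub_delta_lower w o y x z hyo hxo hzo (Ne.symm hxy) hyz hxz hiso' F hF
  rw [union_comm (openConn o y : Set (BondConfig V)) (openConn o x)] at P2y
  have L1 := dd_nonneg w o x y z hxo hyo hzo F hF
  have L2x := eta_nonpos w o x y z hxo hyo hzo F hF
  have L2y := eta_nonpos w o y x z hyo hxo hzo F hF
  -- the hypotheses as `Δ_x, Δ_y ≥ 0`
  have hΔx : 0 ≤ ∫ ω, (F (openCluster ω x) - F (openCluster ω z)) ∂μ := by
    rw [integral_sub (Integrable.of_finite) (Integrable.of_finite)]; linarith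
  have hΔy : 0 ≤ ∫ ω, (F (openCluster ω y) - F (openCluster ω z)) ∂μ := by
    rw [integral_sub (Integrable.of_finite) (Integrable.of_finite)]; linarith
  -- the conclusion as `Ψ ≥ 0`
  have hΨ : ∫ ω in (openConn o x ∪ openConn o y), (F (openCluster ω o) - F (openCluster ω z)) ∂μ =
      ∫ ω in (openConn o x ∪ openConn o y), F (openCluster ω o) ∂μ -
        ∫ ω in (openConn o x ∪ openConn o y), F (openCluster ω z) ∂μ := integral_sub (hint _ _) (hint _ _)
  have key := star_arith (measureReal_nonneg) (measureReal_nonneg) (measureReal_nonneg) (measureReal_nonneg)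
    (measureReal_nonneg) (measureReal_nonneg) (measureReal_nonneg) hΔx hΔy P1 P2x P2y L1 L2x L2y
  linarith

end Q7Psi

end

end Summit.CriticalPhenomena.PercolationContinuityZ3.Theorems
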